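import Summits.BirchSwinnertonDyer.BirchSwinnertonDyer.Theorems.PrintX10bControlGlueOfClauses
import Summits.BirchSwinnertonDyer.Rank1Residual.Additive.UnramifiedAwayBadPlaces
import Literature.NumberTheory.GaloisCohomology.Howard2004.SelmerARepresentativeLocalProofs
import Literature.NumberTheory.EllipticCurves.ZpExtensionEisensteinReadoutConjStableProofs
import Literature.NumberTheory.EllipticCurves.SubgroupSelmerComplexPlacesProofs
import Literature.NumberTheory.EllipticCurves.ZpExtensionEisensteinReadoutOrdinaryStrictProofs
import Literature.NumberTheory.EllipticCurves.ZpExtensionEisensteinReadoutUnramifiedProofs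
import Literature.NumberTheory.EllipticCurves.ZpExtensionEisensteinReadoutSplitPlacesProofs
import Literature.NumberTheory.EllipticCurves.AnticyclotomicInertiaAboveP
import Literature.NumberTheory.EllipticCurves.AnticyclotomicHeegnerPlacesDecompositionProofs
import Literature.NumberTheory.EllipticCurves.ZpExtensionUnramifiedProofs
import Literature.NumberTheory.EllipticCurves.IwasawaSelmerOrdinaryProofs
import Literature.NumberTheory.EllipticCurves.OrdinaryReductionAscentProofs
import HarnessLib

/-!
# Letter (B4) `Stmt.readoutSelmer` of `stub_controlGlue` PROVED: the readout of Howard's `H¹_{F_𝔮}(K, A_𝔮)` lies in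
# `Sel_{p^∞}(E/K_∞)` (helper for the shared μ-crux `MuInequalityCoherentPairOfPrintCG`, stmt-BirchSwinnertonDyer-23428;
# cell `pub/bsd-print-x9`, seat `bsd-line-x10b-p2` g8, S1-DISCRETE lane)

Summits-side helper, THEOREMS ONLY (no definition, no named fact, no instance, no `sorry`); ROUTE-INDEPENDENT (no `Theses`
import).  It discharges the first of the two readout clauses of `HeegnerMuPartControlGlue.controlGlue_of_clauses`
(`Theorems/PrintX10bControlGlueOfClauses`, (DG4)):
**`HeegnerMuPartControlGlue.stub_readoutSelmer : Stmt.readoutSelmer`** (the registered stub `stub_readoutSelmer` of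
skeleton v8 on stmt-BirchSwinnertonDyer-23428, name + signature verbatim) — for every `m ≥ 1` (`m₁ := 0`) and every
admissible Eisenstein datum, Howard's readout `H¹(K, A_𝔮) → H¹(K_∞, E[p^∞])` (`W.eisensteinTowerReadout`,
`𝔮 = ((γ-1)^m + p)`) maps `H¹_{F_𝔮}(K, A_𝔮) = selmerA` into `Sel_{p^∞}(E/K_∞) = selmerInfty κ`.

The assembly (x10b-p2 g7's per-place bricks, HOME HANDOFF «§ x10b-p2 LEAD g7»):
* `Sel_{p^∞}(E/K_∞) = selmerGroupOver (ker κ)` asks, for every `σ ∈ Γ_K`, the local condition of `conj_σ c` at the chosen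
  place above every `v` / `w`; the readout of `H¹_{F_𝔮}` is `Γ_K`-stable (`conjH1_mem_map_eisensteinTowerReadout_selmerA`,
  (B4-σ)), so `σ = 1` suffices;
* at the infinite places there is no condition, `K` being imaginary quadratic (`mem_localKerOver_completion_of_isTotallyComplex`);
* at a finite `v`, pick a representative `c ∈ H¹(K, T^{(k)})` of the class ADAPTED TO `v` — `loc_v c ∈ F_𝔮(k+1, v)` itself
  (`DVRSetting.exists_of_eq_localization_mem`, this seat's `SelmerARepresentativeLocalProofs`) — and read Howard's `F_𝔮`
  (`eisensteinSelmerStructure`): at `v ∣ p` the saturated strict-ordinary tower ⇒ Greenberg's strict condition over `K_∞`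
  ⇒ (Greenberg LNM 1716 Prop. 2.4 = the cite-only leaf `hCG`, leading binder of the letter) the Kummer condition
  (`eisensteinTowerReadout_of_mem_localKerOver`; frame: good ordinary above `p` by ORD-ASCENT, `I_𝔓 ≰ ker κ` by Brink);
  at `v ∈ S`, `v ∤ p` the saturated unramified tower ⇒ unramified over `K_∞`
  (`…_resH1Hom_inertiaInToH_eq_zero_of_mem_levelCondition`) ⇒ locally trivial (`Additive.unramKer_le_localKerOver`, GV p. 17;
  `I_v ≤ ker κ` by Washington 13.2, `D_v ≰ ker κ` by the Heegner hypothesis + Brink); at a good `v ∉ S`: unramified ⇒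
  either the same (if `D_v ≰ ker κ`) or Milne I.3.8 (if `v` splits completely, `…_mem_localKerOver_of_decomp_le`).
HONEST FRAMING: modulo the cite-only leaf (CG) (a hypothesis of the letter, not discharged here) this is the local-conditions
half of Howard's Prop. 2.2.8 / proof of Thm. 2.2.10 at `𝔮 = T^m + p` for the curve; the index clause (B5) `Stmt.readoutIndex`
is NOT touched; «beyond-print theorem»: no. BSD is not proved by any of this; no summit statement is proved by this seat.

References: [Howard2004HeegnerKolyvagin] Def. 2.1.10, Def. 3.1.2, Lemma 2.2.7 / Prop. 2.2.8, proof of Thm. 2.2.10;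
[GreenbergLNM1716] §2 Prop. 2.1, Prop. 2.4, §3 p. 87; [GreenbergVatsal2000] §2 p. 17; [Brink2007] Thm. 2, Cor. 1;
[Washington1997] Prop. 13.2; [MilneADT2006] I Prop. 3.8.
-/

set_option linter.dupNamespace false
set_option autoImplicit false

noncomputable section

open scoped Classical Pointwise ContRepresentation TensorProduct NumberField

open Function NumberField IsDedekindDomain Field
open Literature Literature.NumberTheory.EllipticCurves WeierstrassCurve
open Literature.NumberTheory.GaloisCohomology Literature.NumberTheory.GaloisCohomology.Howard2004
open Literature.NumberTheory.GaloisRepresentations Literature.NumberTheory.GaloisRepresentations.DiscreteGaloisModule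
open Literature.NumberTheory.EllipticCurves.GreenbergSelmer
open Summit.BirchSwinnertonDyer.BirchSwinnertonDyer.Theorems

namespace Summit.BirchSwinnertonDyer.BirchSwinnertonDyer.Theorems.HeegnerMuPartControlGlue

/-! ## §1 The readout of an `F_𝔮`-local class satisfies the local condition of `Sel_{p^∞}(E/K_∞)` (all finite places) -/

section PerPlace

open Literature.NumberTheory.EllipticCurves.ZpExtension (EisensteinLevel)

variable {K : Type} [Field K] [NumberField K] (W : WeierstrassCurve ℚ) [W.IsElliptic] [W.IsGloballyMinimal]
  {p : ℕ} [hp : Fact p.Prime] (κ : ZpExtension K p) {m : ℕ} (hm : 1 ≤ m)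

variable (π : IwasawaAlgebra p ⧸ Ideal.span {(PowerSeries.X ^ m + PowerSeries.C (p : ℤ_[p]) : IwasawaAlgebra p)})
  (e : ℕ → ℕ)
  (hkill : letI := IwasawaAlgebra.isLocalRing_quotient_X_pow_add_C p hm
    ∀ k, ∀ r ∈ IsLocalRing.maximalIdeal
      (IwasawaAlgebra p ⧸ Ideal.span {(PowerSeries.X ^ m + PowerSeries.C (p : ℤ_[p]) : IwasawaAlgebra p)}) ^ e k,
      ∀ x : EisensteinLevel p m (fun j ↦ geomTorsion (W.baseChange K) ((p : ℤ) ^ j)) (k + 1), r • x = 0)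
  (hker : letI := IwasawaAlgebra.isLocalRing_quotient_X_pow_add_C p hm
    ∀ k, LinearMap.ker ((W.eisensteinTower (κ.unitTwist (-1)) hm).red k) =
      (IsLocalRing.maximalIdeal
        (IwasawaAlgebra p ⧸ Ideal.span {(PowerSeries.X ^ m + PowerSeries.C (p : ℤ_[p]) : IwasawaAlgebra p)}) ^ e k) •
        (⊤ : Submodule (IwasawaAlgebra p ⧸ Ideal.span {(PowerSeries.X ^ m + PowerSeries.C (p : ℤ_[p]) : IwasawaAlgebra p)})
          (EisensteinLevel p m (fun j ↦ geomTorsion (W.baseChange K) ((p : ℤ) ^ j)) (k + 1 + 1))))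
  (hπ : letI := IwasawaAlgebra.isLocalRing_quotient_X_pow_add_C p hm
    π ∈ IsLocalRing.maximalIdeal
      (IwasawaAlgebra p ⧸ Ideal.span {(PowerSeries.X ^ m + PowerSeries.C (p : ℤ_[p]) : IwasawaAlgebra p)}))
  (he : ∀ k, e k ≤ e (k + 1))
  (hπX : π = Ideal.Quotient.mk _ PowerSeries.X) (hek : ∀ k, e (k + 1) - e k = m)

/-- **The readout of a class satisfying Howard's `F_𝔮` at `v` satisfies the local condition of `Sel_{p^∞}(E/K_∞)` at the
place above `v`** (every finite `v`; frame: `K` imaginary quadratic, `p` odd, `κ` anticyclotomic, Heegner hypothesis for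
`N ≠ 0`, `E/ℚ` good ordinary at `p`, `S ⊇ {v ∣ p}` confined to `v ∣ pN` with good reduction off `S ∪ {v ∣ p}`, and the
cite-only leaf (CG) `hCG`).  Case split on `F_𝔮(k+1, v)` (`eisensteinSelmerStructure`): `v ∣ p` —
`eisensteinTowerReadout_of_mem_localKerOver`; `v ∈ S`, `v ∤ p` — unramified over `K_∞` then GV p. 17
(`Additive.unramKer_le_localKerOver`, `D_v ≰ ker κ` by (Heeg) + Brink); `v ∉ S` — split completely: Milne I.3.8, else as
before. [cite: Howard2004HeegnerKolyvagin, Def. 2.1.10, Def. 3.1.2 and Lemma 2.2.7 / Prop. 2.2.8]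
[cite: GreenbergLNM1716, §2 Prop. 2.1 and Prop. 2.4] [cite: GreenbergVatsal2000, §2 p. 17] [cite: Brink2007, Thm. 2 and Cor. 1]
[cite: Washington1997, Prop. 13.2] [cite: MilneADT2006, Ch. I Prop. 3.8] -/
theorem eisensteinTowerReadout_of_mem_localKerOver_of_mem_eisensteinSelmerStructure
    (hK : IsImaginaryQuadratic K) (hp2 : p ≠ 2) (hκ : κ.IsAnticyclotomic) {N : ℕ}
    (hHeeg : SatisfiesHeegnerHypothesis N K) (hN0 : N ≠ 0) (hord : IsOrdinaryAt W p)
    (hCG : Greenberg1999.imKummer_eq_strictCondition_goodOrdinary_numberField)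
    (S : Finset (HeightOneSpectrum (𝓞 K)))
    (hbad : ∀ v, v ∉ S → ((p : ℕ) : 𝓞 K) ∉ v.asIdeal → (W.baseChange K).HasGoodReductionAt v)
    (hSN : ∀ v ∈ S, ((p : ℕ) : 𝓞 K) ∈ v.asIdeal ∨ ((N : ℕ) : 𝓞 K) ∈ v.asIdeal)
    (v : HeightOneSpectrum (𝓞 K)) (k : ℕ)
    (c : galoisCohomology
      ((κ.unitTwist (-1)).eisensteinTwist ((W.baseChange K).torsionGaloisModule ((p : ℤ) ^ (k + 1))) hm (k + 1)) 1)
    (hc : galoisCohomology.localization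
        ((κ.unitTwist (-1)).eisensteinTwist ((W.baseChange K).torsionGaloisModule ((p : ℤ) ^ (k + 1))) hm (k + 1))
        (Sum.inr v) 1 c ∈
      (κ.unitTwist (-1)).eisensteinSelmerStructure (fun j ↦ (W.baseChange K).torsionGaloisModule ((p : ℤ) ^ j))
        (fun j ↦ (W.baseChange K).torsionGaloisModuleReduce p j) hm S
        (fun v _ ↦ (W.baseChange K).ordinaryFiltrationAt v (fun j ↦ (W.baseChange K).torsionGaloisModuleReduce p j)
          (fun _ _ ↦ rfl)) (k + 1) (Sum.inr v)) :
    letI := IwasawaAlgebra.isLocalRing_quotient_X_pow_add_C p hm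
    W.eisensteinTowerReadout κ hm π e hkill hker hπ he hπX hek
        (AddCommGroup.DirectLimit.of _ _ k c :
          AdicTower.H1A (W.eisensteinTower (κ.unitTwist (-1)) hm) π e hkill hker hπ he) ∈
      (W.baseChange K).localKerOver p κ.kerSubgroup (v.adicCompletion K) := by
  letI := IwasawaAlgebra.isLocalRing_quotient_X_pow_add_C p hm
  by_cases hpv : ((p : ℕ) : 𝓞 K) ∈ v.asIdeal
  · -- `v ∣ p`: Howard's ordinary condition ⇒ Greenberg strict ⇒ (CG) Kummer
    rw [ZpExtension.eisensteinSelmerStructure_inr_of_mem _ _ _ _ _ _ _ hpv] at hc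
    have hgood : (W.baseChange K).HasGoodReductionAt v :=
      W.hasGoodReductionAt_baseChange_of_hasGoodReductionAtPrime hord.1 v hpv
    have hur : (W.baseChange K).HasUnitRootAt v := by
      rw [WeierstrassCurve.hasUnitRootAt_iff, WeierstrassCurve.ringChar_residueField_eq v hp.out hpv]
      exact W.not_dvd_frobeniusTraceAt_baseChange_of_isOrdinaryAt hord v hpv
    have hram : ∃ 𝔓 ∈ v.primesAbove, ¬ 𝔓.inertia (absoluteGaloisGroup K) ≤ κ.kerSubgroup :=
      ⟨adicCompletionPrime K v, adicCompletionPrime_mem_primesAbove K v,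
        ZpExtension.inertia_not_le_kerSubgroup_of_isAnticyclotomic hK hp2 κ hκ hpv
          (adicCompletionPrime_mem_primesAbove K v)⟩
    exact W.eisensteinTowerReadout_of_mem_localKerOver κ hm π e hkill hker hπ he hπX hek v hpv hgood hur hram hCG k c hc
  · -- `v ∤ p`: `I_v ≤ ker κ` (Washington 13.2)
    have hI : inertia v ≤ κ.kerSubgroup := by
      rw [show inertia v = (adicCompletionPrime K v).inertia (absoluteGaloisGroup K) from
        (inertia_adicCompletionPrime_eq_map_absInertia K v).symm]
      exact ZpExtension.inertia_le_kerSubgroup_holds K p κ hpv (adicCompletionPrime_mem_primesAbove K v)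
    by_cases hvS : v ∈ S
    · -- `v ∈ S`, `v ∤ p` (so `v ∣ N`): saturated unramified ⇒ unramified over `K_∞` ⇒ locally trivial (GV p. 17)
      rw [ZpExtension.eisensteinSelmerStructure_inr_of_mem_of_not_mem _ _ _ _ _ _ _ hpv hvS] at hc
      have hD : ¬ decomp v ≤ κ.kerSubgroup :=
        ZpExtension.decomp_not_le_kerSubgroup_of_natCast_mem_of_satisfiesHeegnerHypothesis hK κ hκ hHeeg hN0 v hpv
          ((hSN v hvS).resolve_left hpv)
      refine Summit.BirchSwinnertonDyer.Rank1Residual.Additive.unramKer_le_localKerOver (κ := κ) (v := v)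
        (W := W.baseChange K) (p := p) hI hD ?_
      rw [Summit.BirchSwinnertonDyer.Rank1Residual.X2.GreenbergVatsalTorsion.unramKer, AddMonoidHom.mem_ker]
      exact W.eisensteinTowerReadout_resH1Hom_inertiaInToH_eq_zero_of_mem_levelCondition κ hm π e hkill hker hπ he
        hπX hek v k c hc
    · -- `v ∉ S` (good, `v ∤ p`): unramified; split completely ⇒ Milne I.3.8, else GV p. 17
      rw [ZpExtension.eisensteinSelmerStructure_inr_of_not_mem _ _ _ _ _ _ _ hpv hvS] at hc
      have hgood : (W.baseChange K).HasGoodReductionAt v := hbad v hvS hpv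
      by_cases hD : decomp v ≤ κ.kerSubgroup
      · exact W.eisensteinTowerReadout_mem_localKerOver_of_decomp_le κ hm π e hkill hker hπ he hπX hek v hgood hD k c hc
      · refine Summit.BirchSwinnertonDyer.Rank1Residual.Additive.unramKer_le_localKerOver (κ := κ) (v := v)
          (W := W.baseChange K) (p := p) hI hD ?_
        rw [Summit.BirchSwinnertonDyer.Rank1Residual.X2.GreenbergVatsalTorsion.unramKer, AddMonoidHom.mem_ker]
        exact W.eisensteinTowerReadout_resH1Hom_inertiaInToH_eq_zero_of_mem_unramifiedSubgroup κ hm π e hkill hker hπ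
          he hπX hek v k c hc

end PerPlace

/-! ## §2 Letter (B4) proved = the registered stub `stub_readoutSelmer : Stmt.readoutSelmer` of skeleton v8 -/

/-- **Letter (B4) `Stmt.readoutSelmer` of `stub_controlGlue` holds** (with `m₁ := 0`): the readout of Howard's
`H¹_{F_𝔮}(K, A_𝔮)` lies in `Sel_{p^∞}(E/K_∞)` on every `Thm413Hypotheses` frame granted (CG).  Reduce to `σ = 1` by
`Γ_K`-stability of the readout ((B4-σ)), discard the complex places, and at a finite `v` read the `v`-adapted representative
through §1. [cite: Howard2004HeegnerKolyvagin, Lemma 2.2.7 / Prop. 2.2.8 and proof of Thm. 2.2.10 (𝔮 = T^m + p)]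
[cite: GreenbergLNM1716, §2 Prop. 2.4 and §3 p. 87] [cite: GreenbergVatsal2000, §2 p. 17] -/
theorem stub_readoutSelmer : Stmt.readoutSelmer := by
  intro hCG N _ W _ K _ _ p _ κ γ jbar hyp _hCM _hirr _hirrK _hsc _hHp _hhK
  haveI := hyp.isElliptic
  refine ⟨0, fun m hm _ ↦ ?_⟩
  letI := IwasawaAlgebra.isDomain_quotient_X_pow_add_C p hm
  letI := IwasawaAlgebra.isDiscreteValuationRing_quotient_X_pow_add_C p hm
  haveI := IwasawaAlgebra.EisensteinCoeff.isLocalRing_succ p hm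
  letI := IwasawaAlgebra.EisensteinCoeff.algebraOfSpecSucc p m
  haveI := W.isScalarTower_algebraOfSpecSucc (K := K) (p := p) (m := m)
  letI := W.residueModuleSucc (K := K) (p := p) hm
  intro S hpS hbad hSN hSσ L hL hLS jbar' cd Dd fs hy hπ he hπX hek a ha
  haveI : IsTotallyComplex K := hyp.isImaginaryQuadratic.2
  have hN0 : N ≠ 0 := NeZero.ne N
  rw [WeierstrassCurve.selmerInfty, WeierstrassCurve.mem_selmerGroupOver_iff]
  refine ⟨fun v σ ↦ ?_,
    fun w σ ↦ (W.baseChange K).mem_localKerOver_completion_of_isTotallyComplex p κ.kerSubgroup w _⟩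
  -- (σ): the readout of `H¹_F(K, A_𝔮)` is `Γ_K`-stable
  obtain ⟨a', ha', ha'eq⟩ := W.conjH1_mem_map_eisensteinTowerReadout_selmerA κ hm _ _ hy.killed hy.ker_red hπ he hπX hek
    hyp.topGenerator _ hy.cond_smul σ _ ⟨a, ha, rfl⟩
  rw [← ha'eq]
  -- a representative adapted to `v`, read through §1
  obtain ⟨k, c, rfl, hc⟩ := DVRSetting.exists_of_eq_localization_mem _ hy hπ he ha' (Sum.inr v)
  exact eisensteinTowerReadout_of_mem_localKerOver_of_mem_eisensteinSelmerStructure W κ hm _ _ hy.killed hy.ker_red hπ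
    he hπX hek hyp.isImaginaryQuadratic hyp.p_ne_two hyp.anticyclotomic hyp.heegner hN0 hyp.ordinary hCG S hbad hSN v
    k c hc

end Summit.BirchSwinnertonDyer.BirchSwinnertonDyer.Theorems.HeegnerMuPartControlGlue

end
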